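import Mathlib
import Literature.Probability.RandomPlanarGeometry.HexSAWObservable
import Summits.CriticalPhenomena.SAWScalingLimit.Theorems.NoFoldBound.Negative.SingletonTightness

/-!
# `NoFoldBound`, line `Ideator3Sketch`: the walled-triple inequality (stub `stub_algebra`, part A)

Crux `NoFoldBound` (stmt-CriticalPhenomena-8296), route `SAWDevelopingMap`.  This file proves the
first of the two finite-dimensional inequalities of the stub `stub_algebra` of the line skeleton
(`stub_algebra_A` below): at a walled vertex the three port values are
`F_u = x (e(-επ/3) P₁ + e(επ/3) P₂)`, `F₁ = P₁ + x e(-επ/3) P₂`, `F₂ = P₂ + x e(επ/3) P₁`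
(`e(t) = e^{-iσt}`, `σ = 5/8`, `x = x_c`, `ε = ±1`, `P₁ = r₁θ`, `P₂ = r₂θ e^{iσ·2επ/3}`,
`r₁, r₂ ≥ 0`, `|θ| = 1`), and for all six labellings `(G₀, G₁, G₂)` of `(F_u, F₁, F₂)`

  `‖G₀ + ω G₁ + ω² G₂‖ ≤ (β_T / α_T) ‖F_u + F₁ + F₂‖`,  `ω = e^{2πi/3}`,

`α_T = 1 + 2 x_c cos(5π/24)`, `β_T = 1 + 2 x_c cos(11π/24)`.

Proof: `F_u + F₁ + F₂ = α_T (P₁ + P₂)`; `F_u + ωF₁ + ω²F₂ = c₁ ω (P₁ + ωP₂)` and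
`F_u + ωF₂ + ω²F₁ = c₂ ω² (P₁ + ω²P₂)` with `{c₁, c₂} = {β_T, 1 - 2x_c cos(π/8)} = {β_T, 0}`
(which is which depends on `ε`); the other four labellings are these two times the units `ω`,
`ω²`; finally `|P₁ + ω^{±1} P₂| ≤ |P₁ + P₂|` for the non-vanishing labelling because the phases of
`P₁, P₂` differ by `75°` while `75° ± 120°` has a smaller cosine.  The algebra is done once, for
abstract units, in `partA_core`.  Unit complex numbers are written `exp(it)`,
`Complex.exp ((t : ℝ) * Complex.I)`, throughout.  The last section collects the numerical facts
(`x_c < 0.55`, `sin(π/8) < 0.394`, `√3 < 1.7321`, `α_T - β_T = 2√3 x_c sin(π/8)`) used by part B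
(file `SAWDevelopingMapNoFoldBoundAlgebra.lean`).
-/

noncomputable section

open Literature.Probability.RandomPlanarGeometry.SAW

namespace Summit.CriticalPhenomena.SAWScalingLimit.Theorems.SAWDevelopingMapNoFoldBound

/-! ## Unit complex numbers `e^{it}` -/

/-- `exp z = e^{it}` once `z = it`. -/
theorem exp_eq_expI {z : ℂ} {t : ℝ} (h : z = t * Complex.I) :
    Complex.exp z = Complex.exp ((t : ℝ) * Complex.I) := by
  rw [h]

/-- `e^{is} e^{it} = e^{i(s + t)}`. -/
theorem expI_mul (s t : ℝ) : Complex.exp ((s : ℝ) * Complex.I) * Complex.exp ((t : ℝ) * Complex.I) =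
    Complex.exp ((s + t : ℝ) * Complex.I) := by
  rw [← Complex.exp_add]; push_cast; ring_nf

/-- `(e^{it})² = e^{2it}`. -/
theorem expI_sq (t : ℝ) :
    Complex.exp ((t : ℝ) * Complex.I) ^ 2 = Complex.exp ((2 * t : ℝ) * Complex.I) := by
  rw [sq, expI_mul]; ring_nf

/-- `e^{it} = e^{i(t - 2π)}`. -/
theorem expI_eq_expI_sub_two_pi (t : ℝ) :
    Complex.exp ((t : ℝ) * Complex.I) = Complex.exp ((t - 2 * Real.pi : ℝ) * Complex.I) := by
  push_cast
  rw [sub_mul, Complex.exp_sub, Complex.exp_two_pi_mul_I, div_one]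

/-- `e^{it} + e^{-it} = 2 cos t`. -/
theorem expI_add_expI_neg (t : ℝ) : Complex.exp ((t : ℝ) * Complex.I) +
    Complex.exp ((-t : ℝ) * Complex.I) = ((2 * Real.cos t : ℝ) : ℂ) := by
  have h := Complex.two_cos (t : ℂ)
  rw [← Complex.ofReal_cos] at h
  push_cast at h ⊢
  linear_combination (-1 : ℂ) * h

/-- `(e^{2πi/3})³ = 1`. -/
theorem expI_two_pi_div_three_pow_three :
    Complex.exp ((2 * Real.pi / 3 : ℝ) * Complex.I) ^ 3 = 1 := by
  rw [← Complex.exp_nat_mul]; push_cast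
  rw [show (3 : ℂ) * (2 * (Real.pi : ℂ) / 3 * Complex.I) = 2 * Real.pi * Complex.I by ring]
  exact Complex.exp_two_pi_mul_I

/-! ## The special values at `x = x_c`, `σ = 5/8` -/

/-- `1 + x_c (e^{5πi/24} + e^{-5πi/24}) = α_T`. -/
theorem one_add_xc_mul_sum :
    1 + (hexCriticalFugacity : ℂ) * (Complex.exp ((5 * Real.pi / 24 : ℝ) * Complex.I) +
      Complex.exp ((-(5 * Real.pi / 24) : ℝ) * Complex.I)) =
      ((1 + 2 * hexCriticalFugacity * Real.cos (5 * Real.pi / 24) : ℝ) : ℂ) := by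
  rw [expI_add_expI_neg]; push_cast; ring

/-- `1 + x_c (e^{-5πi/24} + e^{5πi/24}) = α_T`. -/
theorem one_add_xc_mul_sum' :
    1 + (hexCriticalFugacity : ℂ) * (Complex.exp ((-(5 * Real.pi / 24) : ℝ) * Complex.I) +
      Complex.exp ((5 * Real.pi / 24 : ℝ) * Complex.I)) =
      ((1 + 2 * hexCriticalFugacity * Real.cos (5 * Real.pi / 24) : ℝ) : ℂ) := by
  rw [add_comm (Complex.exp _), one_add_xc_mul_sum]

/-- `1 + x_c (ω e^{-5πi/24} + ω² e^{5πi/24}) = β_T` (`ω = e^{2πi/3}`; the angles are `±11π/24`). -/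
theorem one_add_xc_mul_beta :
    1 + (hexCriticalFugacity : ℂ) * (Complex.exp ((2 * Real.pi / 3 : ℝ) * Complex.I) *
      Complex.exp ((-(5 * Real.pi / 24) : ℝ) * Complex.I) +
      Complex.exp ((2 * Real.pi / 3 : ℝ) * Complex.I) ^ 2 *
      Complex.exp ((5 * Real.pi / 24 : ℝ) * Complex.I)) =
      ((1 + 2 * hexCriticalFugacity * Real.cos (11 * Real.pi / 24) : ℝ) : ℂ) := by
  rw [expI_sq, expI_mul, expI_mul,
    expI_eq_expI_sub_two_pi (2 * (2 * Real.pi / 3) + 5 * Real.pi / 24),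
    show 2 * Real.pi / 3 + -(5 * Real.pi / 24) = 11 * Real.pi / 24 by ring,
    show 2 * (2 * Real.pi / 3) + 5 * Real.pi / 24 - 2 * Real.pi = -(11 * Real.pi / 24) by ring,
    expI_add_expI_neg]
  push_cast; ring

/-- `1 + x_c (ω e^{5πi/24} + ω² e^{-5πi/24}) = 1 - 2 x_c cos(π/8) = 0` (the angles are `±21π/24`,
`cos(21π/24) = -cos(π/8)`, and `2 x_c cos(π/8) = 1`). -/
theorem one_add_xc_mul_zero :
    1 + (hexCriticalFugacity : ℂ) * (Complex.exp ((2 * Real.pi / 3 : ℝ) * Complex.I) *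
      Complex.exp ((5 * Real.pi / 24 : ℝ) * Complex.I) +
      Complex.exp ((2 * Real.pi / 3 : ℝ) * Complex.I) ^ 2 *
      Complex.exp ((-(5 * Real.pi / 24) : ℝ) * Complex.I)) = 0 := by
  rw [expI_sq, expI_mul, expI_mul,
    expI_eq_expI_sub_two_pi (2 * (2 * Real.pi / 3) + -(5 * Real.pi / 24)),
    show 2 * Real.pi / 3 + 5 * Real.pi / 24 = 21 * Real.pi / 24 by ring,
    show 2 * (2 * Real.pi / 3) + -(5 * Real.pi / 24) - 2 * Real.pi = -(21 * Real.pi / 24) by ring,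
    expI_add_expI_neg, show 21 * Real.pi / 24 = Real.pi - Real.pi / 8 by ring, Real.cos_pi_sub]
  have h : (2 : ℂ) * hexCriticalFugacity * Real.cos (Real.pi / 8) = 1 := by
    exact_mod_cast HV.two_mul_xc_mul_cos
  push_cast at h ⊢
  linear_combination (-1 : ℂ) * h

/-- `cos(75° + 120°) ≤ cos 75°`: `Re (ω e^{5πi/12}) ≤ Re e^{5πi/12}`. -/
theorem re_omega_mul_le :
    (Complex.exp ((2 * Real.pi / 3 : ℝ) * Complex.I) *
      Complex.exp ((5 * Real.pi / 12 : ℝ) * Complex.I)).re ≤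
      (Complex.exp ((5 * Real.pi / 12 : ℝ) * Complex.I)).re := by
  rw [expI_mul, Complex.exp_ofReal_mul_I_re, Complex.exp_ofReal_mul_I_re,
    show 2 * Real.pi / 3 + 5 * Real.pi / 12 = Real.pi / 12 + Real.pi by ring, Real.cos_add_pi]
  have h1 : 0 ≤ Real.cos (Real.pi / 12) :=
    Real.cos_nonneg_of_mem_Icc ⟨by linarith [Real.pi_pos], by linarith [Real.pi_pos]⟩
  have h2 : 0 ≤ Real.cos (5 * Real.pi / 12) :=
    Real.cos_nonneg_of_mem_Icc ⟨by linarith [Real.pi_pos], by linarith [Real.pi_pos]⟩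
  linarith

/-- `cos(-75° + 240°) ≤ cos(-75°)`: `Re (ω² e^{-5πi/12}) ≤ Re e^{-5πi/12}`. -/
theorem re_omega_sq_mul_le :
    (Complex.exp ((2 * Real.pi / 3 : ℝ) * Complex.I) ^ 2 *
      Complex.exp ((-(5 * Real.pi / 12) : ℝ) * Complex.I)).re ≤
      (Complex.exp ((-(5 * Real.pi / 12) : ℝ) * Complex.I)).re := by
  rw [expI_sq, expI_mul, Complex.exp_ofReal_mul_I_re, Complex.exp_ofReal_mul_I_re,
    show 2 * (2 * Real.pi / 3) + -(5 * Real.pi / 12) = Real.pi - Real.pi / 12 by ring,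
    Real.cos_pi_sub, Real.cos_neg]
  have h1 : 0 ≤ Real.cos (Real.pi / 12) :=
    Real.cos_nonneg_of_mem_Icc ⟨by linarith [Real.pi_pos], by linarith [Real.pi_pos]⟩
  have h2 : 0 ≤ Real.cos (5 * Real.pi / 12) :=
    Real.cos_nonneg_of_mem_Icc ⟨by linarith [Real.pi_pos], by linarith [Real.pi_pos]⟩
  linarith

/-! ## The abstract walled-triple computation -/

/-- For `r₁, r₂ ≥ 0` and `p, q` of the same modulus, `|r₁ + r₂ p| ≤ |r₁ + r₂ q|` as soon as
`Re p ≤ Re q`. -/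
theorem norm_add_mul_le_of_re_le {r₁ r₂ : ℝ} {p q : ℂ} (hr₁ : 0 ≤ r₁) (hr₂ : 0 ≤ r₂)
    (hpq : ‖p‖ = ‖q‖) (hre : p.re ≤ q.re) : ‖(r₁ : ℂ) + r₂ * p‖ ≤ ‖(r₁ : ℂ) + r₂ * q‖ := by
  rw [← sq_le_sq₀ (norm_nonneg _) (norm_nonneg _), Complex.sq_norm, Complex.sq_norm,
    Complex.normSq_apply, Complex.normSq_apply]
  have h : r₂ ^ 2 * (p.re * p.re + p.im * p.im) = r₂ ^ 2 * (q.re * q.re + q.im * q.im) := by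
    rw [← Complex.normSq_apply, ← Complex.normSq_apply, Complex.normSq_eq_norm_sq,
      Complex.normSq_eq_norm_sq, hpq]
  simp only [Complex.add_re, Complex.add_im, Complex.mul_re, Complex.mul_im, Complex.ofReal_re,
    Complex.ofReal_im, zero_mul, sub_zero, add_zero, zero_add]
  nlinarith [mul_nonneg (mul_nonneg hr₁ hr₂) (sub_nonneg.2 hre), h]

/-- **The walled triple, abstract form.** For a cube root of unity `w` of modulus one, a unit `θ`,
reals `r₁, r₂ ≥ 0`, `P₁ = r₁θ`, `P₂ = r₂θv`, `F_u = x(uP₁ + u'P₂)`, `F₁ = P₁ + xuP₂`,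
`F₂ = P₂ + xu'P₁` with `1 + x(u + u') = α > 0`, and each of the two brackets `1 + x(wu' + w²u)`,
`1 + x(wu + w²u')` either vanishing or equal to `β ≥ 0` with, respectively, `Re(wv) ≤ Re v`,
`Re(w²v) ≤ Re v`: all six labellings satisfy `‖G₀ + wG₁ + w²G₂‖ ≤ (β/α)‖F_u + F₁ + F₂‖`. -/
theorem partA_core (x α β r₁ r₂ : ℝ) (u u' v w θ P₁ P₂ Fu F₁ F₂ : ℂ)
    (hw3 : w ^ 3 = 1) (hw : ‖w‖ = 1) (hθ : ‖θ‖ = 1) (hr₁ : 0 ≤ r₁) (hr₂ : 0 ≤ r₂)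
    (hα : 1 + (x : ℂ) * (u + u') = (α : ℂ)) (hα0 : 0 < α) (hβ0 : 0 ≤ β)
    (h₁ : (1 + (x : ℂ) * (w * u' + w ^ 2 * u) = (β : ℂ) ∧ (w * v).re ≤ v.re) ∨
      1 + (x : ℂ) * (w * u' + w ^ 2 * u) = 0)
    (h₂ : (1 + (x : ℂ) * (w * u + w ^ 2 * u') = (β : ℂ) ∧ (w ^ 2 * v).re ≤ v.re) ∨
      1 + (x : ℂ) * (w * u + w ^ 2 * u') = 0)
    (hP₁ : P₁ = r₁ * θ) (hP₂ : P₂ = r₂ * θ * v) (hFu : Fu = x * (u * P₁ + u' * P₂))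
    (hF₁ : F₁ = P₁ + x * u * P₂) (hF₂ : F₂ = P₂ + x * u' * P₁) :
    ‖Fu + w * F₁ + w ^ 2 * F₂‖ ≤ β / α * ‖Fu + F₁ + F₂‖ ∧
      ‖Fu + w * F₂ + w ^ 2 * F₁‖ ≤ β / α * ‖Fu + F₁ + F₂‖ ∧
      ‖F₁ + w * Fu + w ^ 2 * F₂‖ ≤ β / α * ‖Fu + F₁ + F₂‖ ∧
      ‖F₁ + w * F₂ + w ^ 2 * Fu‖ ≤ β / α * ‖Fu + F₁ + F₂‖ ∧
      ‖F₂ + w * Fu + w ^ 2 * F₁‖ ≤ β / α * ‖Fu + F₁ + F₂‖ ∧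
      ‖F₂ + w * F₁ + w ^ 2 * Fu‖ ≤ β / α * ‖Fu + F₁ + F₂‖ := by
  -- the sum mode
  have hS : Fu + F₁ + F₂ = (α : ℂ) * (θ * (r₁ + r₂ * v)) := by
    rw [← hα, hFu, hF₁, hF₂, hP₁, hP₂]; ring
  have hkS : β / α * ‖Fu + F₁ + F₂‖ = β * ‖(r₁ : ℂ) + r₂ * v‖ := by
    rw [hS, norm_mul, norm_mul, hθ, one_mul, Complex.norm_of_nonneg hα0.le]
    field_simp
  have hkS0 : 0 ≤ β / α * ‖Fu + F₁ + F₂‖ := mul_nonneg (div_nonneg hβ0 hα0.le) (norm_nonneg _)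
  have hwv : ‖w * v‖ = ‖v‖ := by rw [norm_mul, hw, one_mul]
  have hw2v : ‖w ^ 2 * v‖ = ‖v‖ := by rw [norm_mul, norm_pow, hw, one_pow, one_mul]
  -- the two basic labellings
  have hL1 : Fu + w * F₁ + w ^ 2 * F₂ =
      (1 + (x : ℂ) * (w * u' + w ^ 2 * u)) * w * (θ * (r₁ + r₂ * (w * v))) := by
    rw [hFu, hF₁, hF₂, hP₁, hP₂]
    linear_combination (-(x : ℂ) * (u * (r₁ * θ) + u' * (r₂ * θ * v) + w * u * (r₂ * θ * v))) * hw3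
  have hL2 : Fu + w * F₂ + w ^ 2 * F₁ =
      (1 + (x : ℂ) * (w * u + w ^ 2 * u')) * w ^ 2 * (θ * (r₁ + r₂ * (w ^ 2 * v))) := by
    rw [hFu, hF₁, hF₂, hP₁, hP₂]
    linear_combination (-((x : ℂ) * u * (r₁ * θ) + x * u' * (r₂ * θ * v) * (1 + w ^ 3) +
      w * (r₂ * θ * v) + x * w * u' * (r₁ * θ) + x * w ^ 2 * u * (r₂ * θ * v))) * hw3
  have hB1 : ‖Fu + w * F₁ + w ^ 2 * F₂‖ ≤ β / α * ‖Fu + F₁ + F₂‖ := by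
    rcases h₁ with ⟨hc, hre⟩ | hc
    · rw [hL1, hc, hkS, norm_mul, norm_mul, norm_mul, hw, hθ, mul_one, one_mul,
        Complex.norm_of_nonneg hβ0]
      exact mul_le_mul_of_nonneg_left (norm_add_mul_le_of_re_le hr₁ hr₂ hwv hre) hβ0
    · rw [hL1, hc, zero_mul, zero_mul, norm_zero]; exact hkS0
  have hB2 : ‖Fu + w * F₂ + w ^ 2 * F₁‖ ≤ β / α * ‖Fu + F₁ + F₂‖ := by
    rcases h₂ with ⟨hc, hre⟩ | hc
    · rw [hL2, hc, hkS, norm_mul, norm_mul, norm_mul, norm_pow, hw, one_pow, hθ, mul_one, one_mul,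
        Complex.norm_of_nonneg hβ0]
      exact mul_le_mul_of_nonneg_left (norm_add_mul_le_of_re_le hr₁ hr₂ hw2v hre) hβ0
    · rw [hL2, hc, zero_mul, zero_mul, norm_zero]; exact hkS0
  refine ⟨hB1, hB2, ?_, ?_, ?_, ?_⟩
  · rw [show F₁ + w * Fu + w ^ 2 * F₂ = w * (Fu + w * F₂ + w ^ 2 * F₁) by
      linear_combination (-F₁) * hw3, norm_mul, hw, one_mul]
    exact hB2
  · rw [show F₁ + w * F₂ + w ^ 2 * Fu = w ^ 2 * (Fu + w * F₁ + w ^ 2 * F₂) by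
      linear_combination (-(F₁ + w * F₂)) * hw3, norm_mul, norm_pow, hw, one_pow, one_mul]
    exact hB1
  · rw [show F₂ + w * Fu + w ^ 2 * F₁ = w * (Fu + w * F₁ + w ^ 2 * F₂) by
      linear_combination (-F₂) * hw3, norm_mul, hw, one_mul]
    exact hB1
  · rw [show F₂ + w * F₁ + w ^ 2 * Fu = w ^ 2 * (Fu + w * F₂ + w ^ 2 * F₁) by
      linear_combination (-(F₂ + w * F₁)) * hw3, norm_mul, norm_pow, hw, one_pow, one_mul]
    exact hB2

/-! ## Part A of `stub_algebra` -/

/-- **Stub `stub_algebra`, part A (walled triple).** With `P₁ = r₁θ`, `P₂ = r₂θ e^{iσ·2επ/3}`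
(`r₁, r₂ ≥ 0`, `|θ| = 1`, `σ = 5/8`, `ε = ±1`), `F_u = x(e(-επ/3)P₁ + e(επ/3)P₂)`,
`F₁ = P₁ + x e(-επ/3)P₂`, `F₂ = P₂ + x e(επ/3)P₁` (`e(t) = e^{-iσt}`, `x = x_c`), all six labellings
satisfy `‖G₀ + ωG₁ + ω²G₂‖ ≤ (β_T/α_T) ‖F_u + F₁ + F₂‖`. -/
theorem stub_algebra_A :
    ∀ (ε : ℝ), (ε = 1 ∨ ε = -1) → ∀ (r₁ r₂ : ℝ) (θ : ℂ), 0 ≤ r₁ → 0 ≤ r₂ → ‖θ‖ = 1 →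
      let x : ℝ := hexCriticalFugacity
      let e : ℝ → ℂ := fun t => Complex.exp (-Complex.I * (5 / 8 : ℝ) * t)
      let P₁ : ℂ := r₁ * θ
      let P₂ : ℂ := r₂ * θ * Complex.exp (Complex.I * (5 / 8 : ℝ) * (2 * ε * Real.pi / 3 : ℝ))
      let Fu : ℂ := x * (e (-(ε * (Real.pi / 3))) * P₁ + e (ε * (Real.pi / 3)) * P₂)
      let F₁ : ℂ := P₁ + x * e (-(ε * (Real.pi / 3))) * P₂
      let F₂ : ℂ := P₂ + x * e (ε * (Real.pi / 3)) * P₁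
      let ω : ℂ := Complex.exp (2 * Real.pi * Complex.I / 3)
      let k : ℝ := (1 + 2 * hexCriticalFugacity * Real.cos (11 * Real.pi / 24)) /
        (1 + 2 * hexCriticalFugacity * Real.cos (5 * Real.pi / 24))
      let S : ℝ := ‖Fu + F₁ + F₂‖
      ‖Fu + ω * F₁ + ω ^ 2 * F₂‖ ≤ k * S ∧ ‖Fu + ω * F₂ + ω ^ 2 * F₁‖ ≤ k * S ∧
      ‖F₁ + ω * Fu + ω ^ 2 * F₂‖ ≤ k * S ∧ ‖F₁ + ω * F₂ + ω ^ 2 * Fu‖ ≤ k * S ∧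
      ‖F₂ + ω * Fu + ω ^ 2 * F₁‖ ≤ k * S ∧ ‖F₂ + ω * F₁ + ω ^ 2 * Fu‖ ≤ k * S := by
  intro ε hε r₁ r₂ θ hr₁ hr₂ hθ
  rcases hε with rfl | rfl
  · intro x e P₁ P₂ Fu F₁ F₂ ω k S
    have eu : e (-(1 * (Real.pi / 3))) = Complex.exp ((5 * Real.pi / 24 : ℝ) * Complex.I) :=
      exp_eq_expI (by push_cast; ring)
    have eu' : e (1 * (Real.pi / 3)) = Complex.exp ((-(5 * Real.pi / 24) : ℝ) * Complex.I) :=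
      exp_eq_expI (by push_cast; ring)
    have ev : Complex.exp (Complex.I * (5 / 8 : ℝ) * (2 * 1 * Real.pi / 3 : ℝ)) =
        Complex.exp ((5 * Real.pi / 12 : ℝ) * Complex.I) := exp_eq_expI (by push_cast; ring)
    have eω : ω = Complex.exp ((2 * Real.pi / 3 : ℝ) * Complex.I) :=
      exp_eq_expI (by push_cast; ring)
    refine partA_core x _ _ r₁ r₂ (e (-(1 * (Real.pi / 3)))) (e (1 * (Real.pi / 3)))
      (Complex.exp (Complex.I * (5 / 8 : ℝ) * (2 * 1 * Real.pi / 3 : ℝ))) ω θ P₁ P₂ Fu F₁ F₂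
      ?_ ?_ hθ hr₁ hr₂ ?_ nfb_alphaT_pos nfb_betaT_nonneg ?_ ?_ rfl rfl rfl rfl rfl
    · rw [eω]; exact expI_two_pi_div_three_pow_three
    · rw [eω]; exact Complex.norm_exp_ofReal_mul_I _
    · rw [eu, eu']; exact one_add_xc_mul_sum
    · left; rw [eω, eu, eu', ev]; exact ⟨one_add_xc_mul_beta, re_omega_mul_le⟩
    · right; rw [eω, eu, eu']; exact one_add_xc_mul_zero
  · intro x e P₁ P₂ Fu F₁ F₂ ω k S
    have eu : e (-(-1 * (Real.pi / 3))) = Complex.exp ((-(5 * Real.pi / 24) : ℝ) * Complex.I) :=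
      exp_eq_expI (by push_cast; ring)
    have eu' : e (-1 * (Real.pi / 3)) = Complex.exp ((5 * Real.pi / 24 : ℝ) * Complex.I) :=
      exp_eq_expI (by push_cast; ring)
    have ev : Complex.exp (Complex.I * (5 / 8 : ℝ) * (2 * -1 * Real.pi / 3 : ℝ)) =
        Complex.exp ((-(5 * Real.pi / 12) : ℝ) * Complex.I) := exp_eq_expI (by push_cast; ring)
    have eω : ω = Complex.exp ((2 * Real.pi / 3 : ℝ) * Complex.I) :=
      exp_eq_expI (by push_cast; ring)
    refine partA_core x _ _ r₁ r₂ (e (-(-1 * (Real.pi / 3)))) (e (-1 * (Real.pi / 3)))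
      (Complex.exp (Complex.I * (5 / 8 : ℝ) * (2 * -1 * Real.pi / 3 : ℝ))) ω θ P₁ P₂ Fu F₁ F₂
      ?_ ?_ hθ hr₁ hr₂ ?_ nfb_alphaT_pos nfb_betaT_nonneg ?_ ?_ rfl rfl rfl rfl rfl
    · rw [eω]; exact expI_two_pi_div_three_pow_three
    · rw [eω]; exact Complex.norm_exp_ofReal_mul_I _
    · rw [eu, eu']; exact one_add_xc_mul_sum'
    · right; rw [eω, eu, eu']; exact one_add_xc_mul_zero
    · left; rw [eω, eu, eu', ev]; exact ⟨one_add_xc_mul_beta, re_omega_sq_mul_le⟩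

/-! ## Numerical facts (used by part B) -/

/-- `x_c < 0.55` (`x_c² (2 + √2) = 1`, `√2 > 1.4`). -/
theorem xc_lt : hexCriticalFugacity < 0.55 := by
  have h := hexCriticalFugacity_sq
  have h0 := nfb_xc_pos
  have h2 : (1.4 : ℝ) < Real.sqrt 2 := (Real.lt_sqrt (by norm_num)).2 (by norm_num)
  have h3 : hexCriticalFugacity ^ 2 * 3.4 ≤ 1 := by
    nlinarith [mul_le_mul_of_nonneg_left h2.le (sq_nonneg hexCriticalFugacity)]
  nlinarith

/-- `sin(π/8) < 0.394`. -/
theorem sin_pi_div_eight_lt : Real.sin (Real.pi / 8) < 0.394 := by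
  have h1 : Real.sin (Real.pi / 8) < Real.pi / 8 := Real.sin_lt (by positivity)
  have h2 := Real.pi_lt_d2
  linarith

/-- `√3 < 1.7321`. -/
theorem sqrt_three_lt : Real.sqrt 3 < 1.7321 := by
  rw [Real.sqrt_lt' (by norm_num)]; norm_num

/-- `α_T - β_T = 2√3 x_c sin(π/8)` (`cos a - cos b = -2 sin((a+b)/2) sin((a-b)/2)`). -/
theorem alphaT_sub_betaT :
    (1 + 2 * hexCriticalFugacity * Real.cos (5 * Real.pi / 24)) -
      (1 + 2 * hexCriticalFugacity * Real.cos (11 * Real.pi / 24)) =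
      2 * Real.sqrt 3 * hexCriticalFugacity * Real.sin (Real.pi / 8) := by
  have h := Real.cos_sub_cos (5 * Real.pi / 24) (11 * Real.pi / 24)
  rw [show (5 * Real.pi / 24 + 11 * Real.pi / 24) / 2 = Real.pi / 3 by ring,
    show (5 * Real.pi / 24 - 11 * Real.pi / 24) / 2 = -(Real.pi / 8) by ring, Real.sin_neg,
    Real.sin_pi_div_three] at h
  linear_combination 2 * hexCriticalFugacity * h

/-- The margin `m(c) = (α_T + β_T) · 2√3 x_c (sin(π/8) - c)` is positive for `c < sin(π/8)`. -/
theorem margin_pos {c : ℝ} (hc : c < Real.sin (Real.pi / 8)) :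
    0 < ((1 + 2 * hexCriticalFugacity * Real.cos (5 * Real.pi / 24)) +
      (1 + 2 * hexCriticalFugacity * Real.cos (11 * Real.pi / 24))) *
      (2 * Real.sqrt 3 * hexCriticalFugacity * (Real.sin (Real.pi / 8) - c)) := by
  have h1 := nfb_alphaT_pos
  have h2 := nfb_betaT_nonneg
  have h3 := nfb_xc_pos
  have h4 : 0 < Real.sqrt 3 := by positivity
  have h5 : 0 < Real.sin (Real.pi / 8) - c := sub_pos.2 hc
  positivity


end Summit.CriticalPhenomena.SAWScalingLimit.Theorems.SAWDevelopingMapNoFoldBound
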